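import Mathlib
import HarnessLib
import Literature.NumberTheory.LFunctions.HorocycleRateHalf
import Literature.NumberTheory.LFunctions.HorocycleRateHalfStrip
import Literature.NumberTheory.LFunctions.HorocyclePhase
import Literature.NumberTheory.LFunctions.HorocycleZeroKernel

/-!
# Discharge of `ArcFourierBound`: the arc transform of a strip test function

This file discharges the named fact `Literature.NumberTheory.LFunctions.ArcFourierBound` of the
skeleton `HorocycleRateHalf.lean` (elementary proof of
`Literature.NumberTheory.LFunctions.zagier_horocycle_rate_half`) by BRIDGING to the twin line
of files landed for `zagier_sarnak_horocycle_rate_half`: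

* `HorocyclePhase.lean` proves, for a strip test `f` (`ContDiff ℝ ∞ f`, `1`-periodic,
  `f z ≠ 0 → a ≤ im z ≤ b`, `0 < a ≤ b`), the pointwise Fourier expansion of the horocycle
  integral `Ψ(w,θ) = ∫_ℝ f(θ - 1/(w(t+i))) dt` with summable coefficients
  (`hasSum_integral_apply_hpt`, `summable_coeffPsi`) and the uniform decay
  `‖∫₀¹ Ψ(w,θ) e(-kθ) dθ‖ ≤ M/|k|³`, all `w > 0`, `k ≠ 0` (`exists_norm_coeffPsi_le`);
* `HorocycleZeroKernel.lean` proves the zero mode `l ∫₀¹ Ψ(l²,θ) dθ = K(l)` with the smooth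
  kernel `K(l) = ∫_{-S}^{S} m(1/(l²+s²)) ds`, `m(h) = ∫₀¹ f(x+ih) dx`, `S = 1 + 1/a`
  (`mul_coeffPsi_zero_eq`, `contDiff_zeroKernel`).

The bridges: an `IsStripFun Y₁ g` is such a strip test with `a = 1/2`, `b = max Y₁ (1/2)`
(`IsStripFun.contDiff`, `IsStripFun.supp`, `HorocycleRateHalfStrip.lean`), and
`θ + arcPt w t = θ - 1/(w(t+i))` (`ofReal_add_arcPt_eq_hpt`), so `Ψ(w, ·) = arcTransform g w`
(`arcTransform_eq_integral_hpt`); the kernel vanishes already on `[2, ∞)` (heights `≤ 1/4`,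
`zeroKernel_eq_zero_of_two_le`). Hence `arcFourierBound_holds`. Everything here is PROVED.

## Mathlib / tree search
Tree: `HorocyclePhase.exists_norm_coeffPsi_le`, `hasSum_integral_apply_hpt`, `summable_coeffPsi`,
`HorocycleZeroKernel.mul_coeffPsi_zero_eq`, `contDiff_zeroKernel`, `horizontalAverage_eq_zero`
(all reused, nothing re-proved); `IsStripFun.contDiff/.supp` (`HorocycleRateHalfStrip.lean`).

## References
* H. Iwaniec, *Spectral Methods of Automorphic Forms*, 2nd ed., AMS GSM 53 (2002), §3.4
  [Iwaniec2002].
-/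

noncomputable section

open Real Complex MeasureTheory Set Filter intervalIntegral
open scoped Topology ContDiff

namespace Literature.NumberTheory.LFunctions

variable {Y₁ : ℝ} {g : ℂ → ℂ}

/-! ### Bridges -/

/-- `arcPt w t = -1/(w(t+i))` (`w ≠ 0`), i.e. `θ + arcPt w t` is the horocycle point of
`HorocyclePhase.lean`. [folklore] -/
theorem ofReal_add_arcPt_eq_hpt {w : ℝ} (hw : w ≠ 0) (θ t : ℝ) :
    (θ : ℂ) + arcPt w t = (θ : ℂ) - 1 / ((w : ℂ) * ((t : ℂ) + I)) := by
  rw [HorocyclePhase.hpt_eq hw]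
  apply Complex.ext
  · simp only [arcPt, Complex.add_re, Complex.ofReal_re, Complex.mul_re, Complex.I_re,
      Complex.I_im, Complex.ofReal_im]
    ring
  · simp only [arcPt, Complex.add_im, Complex.ofReal_im, Complex.mul_im, Complex.I_re,
      Complex.I_im, Complex.ofReal_re]
    ring

/-- The arc transform is the horocycle integral `Ψ(w, θ)` of `HorocyclePhase.lean` (`w ≠ 0`).
[folklore] -/
theorem arcTransform_eq_integral_hpt (g : ℂ → ℂ) {w : ℝ} (hw : w ≠ 0) (θ : ℝ) :
    arcTransform g w θ = ∫ t : ℝ, g ((θ : ℂ) - 1 / ((w : ℂ) * ((t : ℂ) + I))) := by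
  unfold arcTransform
  simp_rw [ofReal_add_arcPt_eq_hpt hw]

namespace IsStripFun

/-- The strip-support hypothesis of the twin files with `a = 1/2`, `b = max Y₁ (1/2)` (so that
`a ≤ b` needs no case distinction). [folklore] -/
theorem supp' (hg : IsStripFun Y₁ g) : ∀ z : ℂ, g z ≠ 0 → 1 / 2 ≤ z.im ∧ z.im ≤ max Y₁ (1 / 2) :=
  fun z hz => ⟨(hg.supp z hz).1, (hg.supp z hz).2.trans (le_max_left _ _)⟩

/-! ### The zero mode -/

/-- The zero-mode kernel of `HorocycleZeroKernel.lean` (with `a = 1/2`, `S = 1 + 1/a`) vanishes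
already for `l ≥ 2`: all heights `1/(l²+s²) ≤ 1/4` are below `1/2`. [folklore] -/
theorem zeroKernel_eq_zero_of_two_le (hg : IsStripFun Y₁ g) {l : ℝ} (hl : 2 ≤ l) :
    ∫ s in (-(1 + 1 / (1 / 2 : ℝ)))..(1 + 1 / (1 / 2 : ℝ)),
      ∫ x in (0:ℝ)..1, g (x + (1 / (l ^ 2 + s ^ 2) : ℝ) * I) = 0 := by
  have h0 : ∀ s : ℝ, ∫ x in (0:ℝ)..1, g (x + (1 / (l ^ 2 + s ^ 2) : ℝ) * I) = 0 := by
    intro s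
    apply HorocycleZeroKernel.horizontalAverage_eq_zero hg.contDiff.continuous hg.supp'
    rintro ⟨h1, -⟩
    have hpos : 0 < l ^ 2 + s ^ 2 := by nlinarith [sq_nonneg s]
    rw [lt_div_iff₀ hpos] at h1
    nlinarith [sq_nonneg s]
  simp only [h0, intervalIntegral.integral_zero]

end IsStripFun

/-! ### Discharge of the named fact -/

/-- **Discharge of `ArcFourierBound`** (`HorocycleRateHalf.lean`): the coefficients are the
Fourier coefficients `∫₀¹ Ψ(w,θ') e(-kθ') dθ'` of the horocycle integral, the constant is that of
`HorocyclePhase.exists_norm_coeffPsi_le`, and the zero-mode profile is the kernel of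
`HorocycleZeroKernel.mul_coeffPsi_zero_eq` (`a = 1/2`). [folklore] -/
theorem arcFourierBound_holds : ArcFourierBound := by
  intro Y₁ g hg
  have ha : (0 : ℝ) < 1 / 2 := by norm_num
  have hab : (1 / 2 : ℝ) ≤ max Y₁ (1 / 2) := le_max_right _ _
  obtain ⟨M, -, hM⟩ := HorocyclePhase.exists_norm_coeffPsi_le hg.contDiff hg.periodic hg.supp' ha hab
  refine ⟨fun k w => ∫ θ' in (0:ℝ)..1, (∫ t : ℝ, g ((θ' : ℂ) - 1 / ((w : ℂ) * ((t : ℂ) + I)))) *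
      Complex.exp (-(2 * π * I * k * θ')), M, fun w hw θ => ?_, fun w hw => ?_,
    fun w hw k hk => hM w hw k hk,
    fun l => ∫ s in (-(1 + 1 / (1 / 2 : ℝ)))..(1 + 1 / (1 / 2 : ℝ)),
      ∫ x in (0:ℝ)..1, g (x + (1 / (l ^ 2 + s ^ 2) : ℝ) * I), ?_, fun s hs =>
      hg.zeroKernel_eq_zero_of_two_le hs, fun u hu => ?_⟩
  · rw [arcTransform_eq_integral_hpt g hw.ne' θ]
    exact HorocyclePhase.hasSum_integral_apply_hpt hg.contDiff hg.periodic hg.supp' ha hab hw θ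
  · exact HorocyclePhase.summable_coeffPsi hg.contDiff hg.periodic hg.supp' ha hab hw
  · simpa using contDiff_infty.mp
      (HorocycleZeroKernel.contDiff_zeroKernel hg.contDiff hg.supp' ha hab (1 + 1 / (1 / 2 : ℝ))) 2
  · exact HorocycleZeroKernel.mul_coeffPsi_zero_eq hg.contDiff.continuous hg.periodic hg.supp' ha hu

/-- **Discharge of `ArcFourierBound` under its canonical name** (`<Fact>_holds`, D-0014/D-0026):
the named fact `ArcFourierBound` of `HorocycleRateHalf.lean` holds — it is `arcFourierBound_holds`
above (Fourier expansion of the arc transform of a strip test function with coefficients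
`O(|k|⁻³)` uniformly in `w > 0`, bridged to `HorocyclePhase.lean` / `HorocycleZeroKernel.lean`;
Iwaniec, *Spectral methods*, §3.4). Real proof. [folklore] -/
theorem ArcFourierBound_holds : ArcFourierBound := arcFourierBound_holds

end Literature.NumberTheory.LFunctions

end
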